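import Mathlib.Analysis.SpecialFunctions.ImproperIntegrals
import Mathlib.LinearAlgebra.Matrix.ConjTranspose
import Literature.Analysis.FluidPDE.Onsager
import Literature.Analysis.FunctionSpaces.HolderNorm
import HarnessLib

/-!
# Onsager 1949, *Statistical hydrodynamics*: ideal turbulence and dissipation without viscosity
(topic: Analysis/FluidPDE; statement source of the problem `AnomalousDissipation`)

L. Onsager, *Statistical hydrodynamics*, Nuovo Cimento (9) **6**, Suppl. 2 (1949), 279–287, is the
origin of two ideas the `AnomalousDissipation` summit rests on: (i) turbulent energy dissipation
does not vanish as the viscosity tends to zero ("the law of dissipation (11) does not involve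
viscosity at all"; in three dimensions "a mechanism for complete dissipation of all kinetic
energy, even without the aid of viscosity, is available"), and (ii) the *Onsager criterion*: an
ideal (Euler) velocity field can dissipate energy only if it violates every Hölder ("Lipschitz")
condition `|v(r' + r) - v(r')| < const · rⁿ` of order `n > 1/3` (his (26)); otherwise energy is
conserved. This file vendors the principal definitions and claims of the *Turbulence* part of the
paper (the two-dimensional point-vortex statistical mechanics of its first part does not bear on
`AnomalousDissipation` and is not vendored here).

## Contents

* §1 **Fourier-space hydrodynamics on the periodic box** (Onsager's (15)–(17)). Wave vectors
  `waveVec k ∈ ℂ^ι` of `k ∈ ℤ^ι`, amplitude fields `a : ℤ^ι → ℂ^ι` with the reality condition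
  `IsRealAmplitude` (`a(-k) = a(k)̄`) and incompressibility `IsTransverse` (`k · a(k) = 0`); the
  advection mode `advectionMode` and Onsager's generalised ("will do" in place of the differential
  equations) formulation `IsFourierNavierStokes ν a` of Navier–Stokes/Euler as an infinite ODE
  system for the Fourier amplitudes (his (15)); the triadic energy transfer
  `energyTransfer a k k' = Q(k,k')` (his (16a)) and **detailed conservation**
  `Q(k,k') + Q(k',k) = 0` (his (17)) — *proved* (`energyTransfer_add_energyTransfer_swap`).
* §2 **Onsager's Hölder criterion.** `UniformHolderOn S n u`: the velocity field obeys (26) with a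
  constant independent of `t ∈ S`; the named fact `Onsager1949_energyConservation` (weak Euler
  solutions on `T³ × (0,T)` obeying (26) uniformly in time with `n > 1/3` conserve energy — proved
  in print by Eyink 1994 and Constantin–E–Titi 1994, cf. `Turb.onsager_rigidity_holder`), its
  contrapositive `…​.not_uniformHolderOn` (Onsager's wording: ideal turbulence "cannot obey any
  Lipschitz condition … of order `n > 1/3`"), the bridge from the tree's `L^∞_t C^{0,n}_x` class
  (`HolderUniformlyBoundedOn.uniformHolderOn`, proved), and the named fact
  `Onsager1949_inviscidDissipation` (energy-non-conserving weak Euler flows on `T³` exist), derived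
  here from the tree's flexibility fact `Turb.onsager_flexibility_strictAntiOn` (proved reduction).
* §3 **The accelerated cascade.** Onsager's step time `cascadeStepTime Q k = Q^{-1/3} k^{-2/3}` and
  the finiteness of the total cascade time `∫_{k₀}^∞ τ(k) dk/k = (3/2) Q^{-1/3} k₀^{-2/3}` — *proved*.

Not restated here (already in the tree): Onsager's dissipation law (11), `Q = A · V³/L` with `A`
independent of the Reynolds number, is `Turb.dissipationCoeff` (TurbWave0) and, as a statement about
Navier–Stokes, the summit `Turb.ZerothLaw` (Summits/AnomalousDissipation); the `Q^{2/3} k^{-5/3}`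
spectrum is `Turb.energySpectrum` / `Turb.IsK41Scaling` (TurbWave0); the modern two-sided Onsager
theorem is `Turb.onsager_rigidity*` / `Turb.onsager_flexibility*` (Onsager.lean).

## Source access

The 1949 paper is not openly available (acquisition request filed). Equation numbers (11), (15),
(16a), (17), (26) and all quotations are Onsager's own, taken from the verbatim transcriptions in
Eyink–Sreenivasan, Rev. Mod. Phys. 78 (2006), §IV.A–B, eqs. (27), (32)–(37) and pp. 102–103, which
bracket Onsager's numbering explicitly ("(15) [our (32)]", "(16a) [our Eq. (34)]", "(17) [our
(35)]", "(26)").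

## Design choices

* Fourier amplitudes are plain functions `(ι → ℤ) → ι → ℂ` with Mathlib's bilinear `dotProduct`
  (`⬝ᵥ`, no conjugation), exactly as Onsager writes `a(k) · a(-k')`; reality is the separate
  hypothesis `IsRealAmplitude`. No summability is built into `energyTransfer` (a single triad);
  the infinite system `IsFourierNavierStokes` asks for `HasSum` of the advection modes, which is
  Onsager's point: (17) does not imply conservation of `∑ |a(k)|²` when the double series converges
  only conditionally.
* The Leray projection symbol `w - (w·k/|k|²) k` uses the division convention at `k = 0` (the
  projection is then the identity; the `k = 0` mode is the conserved mean and its advection sum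
  vanishes for transverse `a`).
* Onsager's condition (26) is Mathlib's `HolderWith C n (u t)` with one `C` for all `t ∈ S`
  (`UniformHolderOn`), stated for general pseudo-emetric spaces; the facts specialise to
  `T³ = UnitAddTorus (Fin 3)` with the tree's `Turb.IsWeakEulerSolution` / `Turb.ConservesEnergyAEOn`.
* Facts are `def … : Prop` (D-0014); reductions between facts are real theorems.

## References

* L. Onsager, *Statistical hydrodynamics*, Nuovo Cimento (9) 6, Suppl. 2 (1949), 279–287.
* G. L. Eyink, K. R. Sreenivasan, *Onsager and the theory of hydrodynamic turbulence*, Rev. Mod.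
  Phys. 78 (2006), 87–135, §IV.
* P. Constantin, W. E, E. S. Titi, Comm. Math. Phys. 165 (1994), 207–209 (proof of the
  conservation claim in `L³_t B^α_{3,∞} ⊃ L^∞_t C^α`, `α > 1/3`).
* C. De Lellis, L. Székelyhidi Jr., Ann. of Math. 170 (2009), Thm. 1.1–1.2; P. Isett, Ann. of
  Math. 188 (2018), Thm. 1 (existence of dissipative weak Euler flows).
-/

open MeasureTheory Set Filter Topology Complex
open scoped NNReal ENNReal Real

noncomputable section

namespace Literature.Analysis.FluidPDE

section Turb

/-! ## §1 Fourier-space hydrodynamics (Onsager 1949, (15)–(17)) -/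

namespace Onsager1949

section Fourier

variable {ι : Type*}

/-- The wave vector `k ∈ ℤ^ι` of a Fourier mode on the unit periodic box, viewed in `ℂ^ι` so that
it can be paired with complex amplitudes (Onsager 1949, (15)). [cite: Onsager1949, eq. (15)] -/
def waveVec (k : ι → ℤ) : ι → ℂ := fun i => (k i : ℂ)

/-- Unfolding lemma for `waveVec`. [folklore] -/
@[simp] theorem waveVec_apply (k : ι → ℤ) (i : ι) : waveVec k i = (k i : ℂ) := rfl

/-- `waveVec` is additive. [folklore] -/
theorem waveVec_add (k k' : ι → ℤ) : waveVec (k + k') = waveVec k + waveVec k' := by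
  ext i; simp

/-- `waveVec` respects subtraction. [folklore] -/
theorem waveVec_sub (k k' : ι → ℤ) : waveVec (k - k') = waveVec k - waveVec k' := by
  ext i; simp

/-- `waveVec` respects negation. [folklore] -/
theorem waveVec_neg (k : ι → ℤ) : waveVec (-k) = -waveVec k := by
  ext i; simp

/-- Wave vectors are real: `star (waveVec k) = waveVec k`. [folklore] -/
@[simp] theorem star_waveVec (k : ι → ℤ) : star (waveVec k) = waveVec k := by
  ext i; simp

/-- Reality of the velocity field in terms of its Fourier amplitudes `a(k) ∈ ℂ^ι`:
`a(-k) = a(k)̄` componentwise (Onsager 1949, text after (15): the field `v(r) = ∑ a(k) e^{2πik·r}`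
is real). [cite: Onsager1949, eq. (15)] -/
def IsRealAmplitude (a : (ι → ℤ) → ι → ℂ) : Prop :=
  ∀ k, a (-k) = star (a k)

variable [Fintype ι]

/-- The squared wavenumber `|k|² = ∑ᵢ kᵢ²` (real). [folklore] -/
def waveNormSq (k : ι → ℤ) : ℝ := ∑ i, (k i : ℝ) ^ 2

/-- Incompressibility `∇ · v = 0` in Fourier space: every amplitude is transverse to its wave
vector, `a(k) · k = 0` (Onsager 1949, (15)). [cite: Onsager1949, eq. (15)] -/
def IsTransverse (a : (ι → ℤ) → ι → ℂ) : Prop :=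
  ∀ k, a k ⬝ᵥ waveVec k = 0

/-- The Leray (solenoidal) projection symbol at wave vector `k`: `w ↦ w - (w · k / |k|²) k`
(Onsager 1949, (15): the pressure eliminates the longitudinal part). Division convention: at
`k = 0` the correction term is `0`. [cite: Onsager1949, eq. (15)] -/
def lerayProj (k : ι → ℤ) (w : ι → ℂ) : ι → ℂ :=
  w - ((w ⬝ᵥ waveVec k) / (waveNormSq k : ℂ)) • waveVec k

/-- One term of the advection sum in Onsager's Fourier form of the equations of motion (his (15);
Eyink–Sreenivasan (32)): the contribution of the pair `(k - k', k')` to `d a(k)/dt` is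
`-2πi [a(k - k') · k'] P_k a(k')` with `P_k` the Leray symbol; this is the bracket without the
prefactor `-2πi`. [cite: Onsager1949, eq. (15)] -/
def advectionMode (b : (ι → ℤ) → ι → ℂ) (k k' : ι → ℤ) : ι → ℂ :=
  (b (k - k') ⬝ᵥ waveVec k') • lerayProj k (b k')

/-- With zero amplitudes every advection mode vanishes. [folklore] -/
@[simp] theorem advectionMode_zero (k k' : ι → ℤ) :
    advectionMode (0 : (ι → ℤ) → ι → ℂ) k k' = 0 := by
  simp [advectionMode]

/-- **Onsager's Fourier formulation of incompressible hydrodynamics** (Onsager 1949, (15); the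
"more general description" which "will do" when the velocity field is not differentiable, closing
paragraph). A time-dependent amplitude field `a : ℝ → ℤ^ι → ℂ^ι` solves Navier–Stokes with
viscosity `ν` (Euler for `ν = 0`) on the unit periodic box when, for every wave vector `k` and
time `t`, the advection series `∑_{k'} [a(k - k') · k'] P_k a(k')` converges (to some `N`) and
`d a(k)/dt = -2πi N - ν |2πk|² a(k)`. Convergence is *summability* (`HasSum`, unconditional);
Onsager stresses that the physically relevant regime is where such sums converge only
conditionally, so this is the strong reading of (15). [cite: Onsager1949, eq. (15)] -/
def IsFourierNavierStokes (ν : ℝ) (a : ℝ → (ι → ℤ) → ι → ℂ) : Prop :=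
  ∀ (k : ι → ℤ) (t : ℝ), ∃ N : ι → ℂ, HasSum (fun k' => advectionMode (a t) k k') N ∧
    HasDerivAt (fun s => a s k)
      (-(2 * π * I) • N - ((ν * (2 * π) ^ 2 * waveNormSq k : ℝ) : ℂ) • a t k) t

/-- Onsager's Fourier form of the incompressible **Euler** equations ("ideal" turbulence):
`IsFourierNavierStokes` with `ν = 0` (Onsager 1949, (15) and closing paragraph). [cite: Onsager1949, eq. (15)] -/
abbrev IsFourierEuler (a : ℝ → (ι → ℤ) → ι → ℂ) : Prop :=
  IsFourierNavierStokes 0 a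

/-- The fluid at rest solves Onsager's Fourier system (non-vacuity of the definition). [folklore] -/
theorem isFourierNavierStokes_zero (ν : ℝ) :
    IsFourierNavierStokes ν (0 : ℝ → (ι → ℤ) → ι → ℂ) := by
  intro k t
  refine ⟨0, ?_, ?_⟩
  · simp
  · simpa using hasDerivAt_const t (0 : ι → ℂ)

/-- The complex bracket of Onsager's triadic transfer function (his (16a); Eyink–Sreenivasan (34)):
`[a(k + k') · k'] [a(-k) · a(-k')] + [a(k' - k) · k'] [a(k) · a(-k')]`, all products bilinear.
[cite: Onsager1949, eq. (16a)] -/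
def transferAmplitude (a : (ι → ℤ) → ι → ℂ) (k k' : ι → ℤ) : ℂ :=
  (a (k + k') ⬝ᵥ waveVec k') * (a (-k) ⬝ᵥ a (-k')) +
    (a (k' - k) ⬝ᵥ waveVec k') * (a k ⬝ᵥ a (-k'))

/-- **Onsager's energy-transfer function** `Q(k,k')` (Onsager 1949, (16a); Eyink–Sreenivasan
(33)–(34)): the instantaneous rate at which energy leaves the wavenumber pair `±k` for the pair
`±k'` under the Euler nonlinearity, `Q(k,k') = πi {…} + c.c. = 2 Re (πi · transferAmplitude)`, so
that formally `d|a(k)|²/dt = -2ν|2πk|²|a(k)|² + ∑_{k'} Q(k,k')`. [cite: Onsager1949, eq. (16a)] -/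
def energyTransfer (a : (ι → ℤ) → ι → ℂ) (k k' : ι → ℤ) : ℝ :=
  2 * ((π : ℂ) * I * transferAmplitude a k k').re

/-- `Q(k,k') = -2π Im {…}`. [folklore] -/
theorem energyTransfer_eq_im (a : (ι → ℤ) → ι → ℂ) (k k' : ι → ℤ) :
    energyTransfer a k k' = -2 * π * (transferAmplitude a k k').im := by
  simp [energyTransfer, Complex.mul_re, Complex.mul_im]
  ring

/-- Complex conjugation is multiplicative on the bilinear dot product. [folklore] -/
theorem star_dotProduct_eq (v w : ι → ℂ) :
    star (v ⬝ᵥ w) = star v ⬝ᵥ star w := by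
  rw [Matrix.star_dotProduct_star, dotProduct_comm]

variable {a : (ι → ℤ) → ι → ℂ}

/-- The two brackets of a triad are complex conjugate up to terms killed by incompressibility:
for a real, transverse amplitude field, `transferAmplitude a k k' + transferAmplitude a k' k =
X + X̄` with `X = [a(k' - k) · k'] [a(k) · a(-k')]`. [folklore] -/
theorem transferAmplitude_add_swap (hr : IsRealAmplitude a) (hd : IsTransverse a)
    (k k' : ι → ℤ) :
    transferAmplitude a k k' + transferAmplitude a k' k =
      (a (k' - k) ⬝ᵥ waveVec k') * (a k ⬝ᵥ a (-k')) +
        star ((a (k' - k) ⬝ᵥ waveVec k') * (a k ⬝ᵥ a (-k'))) := by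
  -- incompressibility of the modes `k + k'` and `k - k'`
  have h1 : a (k + k') ⬝ᵥ waveVec k = -(a (k + k') ⬝ᵥ waveVec k') := by
    have := hd (k + k')
    rw [waveVec_add, dotProduct_add] at this
    linear_combination this
  have h2 : a (k - k') ⬝ᵥ waveVec k = a (k - k') ⬝ᵥ waveVec k' := by
    have := hd (k - k')
    rw [waveVec_sub, dotProduct_sub] at this
    linear_combination this
  -- reality turns the second bracket of `Q(k',k)` into the conjugate of that of `Q(k,k')`
  have hstar : star ((a (k' - k) ⬝ᵥ waveVec k') * (a k ⬝ᵥ a (-k'))) =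
      (a (k - k') ⬝ᵥ waveVec k) * (a k' ⬝ᵥ a (-k)) := by
    rw [star_mul', star_dotProduct_eq, star_dotProduct_eq, star_waveVec, ← hr, ← hr, ← hr,
      neg_sub, neg_neg, h2, dotProduct_comm (a (-k)) (a k')]
  rw [hstar]
  simp only [transferAmplitude]
  rw [add_comm k' k, h1, dotProduct_comm (a (-k')) (a (-k))]
  ring

/-- **Detailed conservation of energy** (Onsager 1949, (17); Eyink–Sreenivasan (35)): for a real,
divergence-free amplitude field the triadic transfer is antisymmetric, `Q(k,k') + Q(k',k) = 0` —
energy leaving `±k` through a triad appears in `±k'`, the third wave vector acting only as a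
catalyst. Onsager's point (closing paragraph) is that this does **not** imply conservation of the
total energy `∑ |a(k)|²` when the cascade has infinitely many steps and `∑∑ Q(k,k')` converges
only conditionally. [cite: Onsager1949, eq. (17)] -/
theorem energyTransfer_add_energyTransfer_swap (hr : IsRealAmplitude a) (hd : IsTransverse a)
    (k k' : ι → ℤ) : energyTransfer a k k' + energyTransfer a k' k = 0 := by
  set X : ℂ := (a (k' - k) ⬝ᵥ waveVec k') * (a k ⬝ᵥ a (-k')) with hX
  have hsum : transferAmplitude a k k' + transferAmplitude a k' k = X + star X :=
    transferAmplitude_add_swap hr hd k k'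
  have hre : ((π : ℂ) * I * (X + star X)).re = 0 := by
    simp [Complex.mul_re, Complex.mul_im]
  simp only [energyTransfer]
  rw [← mul_add, ← Complex.add_re, ← mul_add, hsum, hre, mul_zero]

/-- In particular no triad transfers energy from a wavenumber pair to itself: `Q(k,k) = 0`. [folklore] -/
theorem energyTransfer_self (hr : IsRealAmplitude a) (hd : IsTransverse a) (k : ι → ℤ) :
    energyTransfer a k k = 0 := by
  have := energyTransfer_add_energyTransfer_swap hr hd k k
  linarith

end Fourier

/-! ## §3 The accelerated cascade (Onsager 1949, §"Turbulence") -/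

section Cascade

/-- Onsager's cascade step (turnover) time at wavenumber `k` for energy flux `Q` per unit mass:
`τ(k) = Q^{-1/3} k^{-2/3}`, the only time that dimensional analysis builds from `Q` and `k`
(Onsager 1949, Turbulence section; Eyink–Sreenivasan (36)). Real powers (`Real.rpow`), so junk
values for `Q ≤ 0` or `k ≤ 0`. [cite: Onsager1949, §Turbulence (cascade turnover time; EyinkSreenivasan2006 eq. (36))] -/
def cascadeStepTime (Q k : ℝ) : ℝ := Q ^ (-(1 / 3 : ℝ)) * k ^ (-(2 / 3 : ℝ))

/-- `τ(k)/k = Q^{-1/3} k^{-5/3}` for `k > 0`. [folklore] -/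
theorem cascadeStepTime_div {k : ℝ} (Q : ℝ) (hk : 0 < k) :
    cascadeStepTime Q k / k = Q ^ (-(1 / 3 : ℝ)) * k ^ (-(5 / 3 : ℝ)) := by
  rw [cascadeStepTime, mul_div_assoc, ← Real.rpow_sub_one hk.ne']
  norm_num

/-- **The cascade is accelerated: its total duration is finite** (Onsager 1949, Turbulence
section; Eyink–Sreenivasan (36)–(37)). Summing the step times over a geometric ladder of
wavenumbers, i.e. integrating `τ(k) dk/k`, from `k₀ > 0` to `∞` gives the finite value
`(3/2) Q^{-1/3} k₀^{-2/3}`: if not intercepted by viscosity, energy injected at wavenumber `k₀`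
reaches `k = ∞` in finite time. [cite: Onsager1949, §Turbulence (finite cascade time; EyinkSreenivasan2006 eq. (37))] -/
theorem integral_cascadeStepTime_div {k₀ : ℝ} (Q : ℝ) (hk₀ : 0 < k₀) :
    ∫ k in Ioi k₀, cascadeStepTime Q k / k =
      3 / 2 * Q ^ (-(1 / 3 : ℝ)) * k₀ ^ (-(2 / 3 : ℝ)) := by
  have hcongr : EqOn (fun k => cascadeStepTime Q k / k)
      (fun k => Q ^ (-(1 / 3 : ℝ)) * k ^ (-(5 / 3 : ℝ))) (Ioi k₀) :=
    fun k hk => cascadeStepTime_div Q (hk₀.trans hk)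
  rw [setIntegral_congr_fun measurableSet_Ioi hcongr, MeasureTheory.integral_const_mul,
    integral_Ioi_rpow_of_lt (by norm_num) hk₀,
    show (-(5 / 3 : ℝ) + 1) = -(2 / 3 : ℝ) by norm_num]
  ring

/-- The total cascade time from `k₀ > 0` is positive when `Q > 0`. [folklore] -/
theorem integral_cascadeStepTime_div_pos {Q k₀ : ℝ} (hQ : 0 < Q) (hk₀ : 0 < k₀) :
    0 < ∫ k in Ioi k₀, cascadeStepTime Q k / k := by
  rw [integral_cascadeStepTime_div Q hk₀]
  have h1 : 0 < Q ^ (-(1 / 3 : ℝ)) := Real.rpow_pos_of_pos hQ _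
  have h2 : 0 < k₀ ^ (-(2 / 3 : ℝ)) := Real.rpow_pos_of_pos hk₀ _
  positivity

end Cascade

end Onsager1949

/-! ## §2 Onsager's Hölder criterion (26) and dissipation without viscosity -/

section HolderCriterion

variable {X Y : Type*} [PseudoEMetricSpace X] [PseudoEMetricSpace Y]

/-- **Onsager's "Lipschitz condition of order `n`", uniformly in time** (Onsager 1949, (26)):
there is one constant `C` with `|u(t, x') - u(t, x)| ≤ C · d(x, x')ⁿ` for all `t ∈ S` and all
`x, x'`, i.e. `HolderWith C n (u t)` for every `t ∈ S` (Mathlib's Hölder condition, exponent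
`n : ℝ≥0`). [cite: Onsager1949, eq. (26)] -/
def UniformHolderOn (S : Set ℝ) (n : ℝ≥0) (u : ℝ → X → Y) : Prop :=
  ∃ C : ℝ≥0, ∀ t ∈ S, HolderWith C n (u t)

variable {S S' : Set ℝ} {n : ℝ≥0} {u : ℝ → X → Y}

/-- Restriction of the time set. [folklore] -/
theorem UniformHolderOn.mono (h : UniformHolderOn S n u) (hS : S' ⊆ S) : UniformHolderOn S' n u :=
  h.imp fun _ hC t ht => hC t (hS ht)

/-- Each time slice of a uniformly Hölder field is Hölder. [folklore] -/
theorem UniformHolderOn.memHolder (h : UniformHolderOn S n u) {t : ℝ} (ht : t ∈ S) :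
    MemHolder n (u t) :=
  h.imp fun _ hC => hC t ht

/-- A time-independent field obeys (26) uniformly iff it is Hölder. [folklore] -/
theorem uniformHolderOn_const_iff {v : X → Y} (hS : S.Nonempty) :
    UniformHolderOn S n (fun _ => v) ↔ MemHolder n v :=
  ⟨fun ⟨C, hC⟩ => ⟨C, hC _ hS.some_mem⟩, fun ⟨C, hC⟩ => ⟨C, fun _ _ => hC⟩⟩

end HolderCriterion

section HolderBridge

variable {X Y : Type*} [MetricSpace X] [NormedAddCommGroup Y] {S : Set ℝ} {n : ℝ≥0}
  {u : ℝ → X → Y}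

/-- The tree's class `L^∞_t C^{0,n}_x` (`Literature.Analysis.FunctionSpaces.HolderUniformlyBoundedOn`: `sup_{t ∈ S} ‖u t‖_{C^{0,n}}
< ∞`) satisfies Onsager's uniform condition (26), with constant the supremum of the Hölder norms
(stated for a metric space `X`, where Mathlib's `MemHolder.holderWith` lives). [folklore] -/
theorem _root_.Literature.Analysis.FunctionSpaces.HolderUniformlyBoundedOn.uniformHolderOn (h : FunctionSpaces.HolderUniformlyBoundedOn S n u) :
    UniformHolderOn S n u := by
  set M : ℝ≥0∞ := ⨆ t ∈ S, FunctionSpaces.eBoundedHolderNorm n (u t) with hM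
  have hMtop : M ≠ ∞ := ne_of_lt h
  refine ⟨M.toNNReal, fun t ht => ?_⟩
  have hle : eHolderNorm n (u t) ≤ M :=
    (le_add_self : eHolderNorm n (u t) ≤ FunctionSpaces.eBoundedHolderNorm n (u t)).trans
      (le_iSup₂ (f := fun t (_ : t ∈ S) => FunctionSpaces.eBoundedHolderNorm n (u t)) t ht)
  have hmem : MemHolder n (u t) := eHolderNorm_lt_top.1 (hle.trans_lt (lt_top_iff_ne_top.2 hMtop))
  refine hmem.holderWith.mono ?_
  rw [← ENNReal.coe_le_coe, ENNReal.coe_toNNReal hMtop, hmem.coe_nnHolderNorm_eq_eHolderNorm]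
  exact hle

end HolderBridge


section Claims

/-- The flat three-torus `T³ = (ℝ/ℤ)³`, local notation. -/
local notation "𝕋³" => UnitAddTorus (Fin 3)

/-- Euclidean `ℝ³`, local notation. -/
local notation "ℝ³" => EuclideanSpace ℝ (Fin 3)

/-- **Onsager's conservation claim** (Onsager 1949, closing paragraph with condition (26): the
velocity field of ideal turbulence "cannot obey any LIPSCHITZ condition of the form
`|v(r' + r) - v(r')| < (const.) rⁿ` for any order `n` greater than `1/3`; otherwise the energy is
conserved", the laws of motion being understood in the generalised sense). Rendered on the
periodic box `T³`: a weak (distributional) solution `u` of incompressible Euler on `T³ × (0,T)`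
(`Turb.IsWeakEulerSolution`) which satisfies (26) with one constant for all `t ∈ (0,T)` and some
`n > 1/3` conserves kinetic energy, `E(u(s)) = E(u(t))` for a.e. `s, t ∈ (0,T)`
(`Turb.ConservesEnergyAEOn`). Proved in print: Eyink, Physica D 78 (1994) (Fourier form under a
slightly stronger hypothesis); Constantin–E–Titi, CMP 165 (1994) (in `L³_t B^α_{3,∞} ⊃ L^∞_t C^α`);
the tree records the latter as `Turb.onsager_rigidity_holder`. [cite: Onsager1949, eq. (26) and closing paragraph] -/
def Onsager1949_energyConservation : Prop :=
  ∀ ⦃T : ℝ⦄ ⦃n : ℝ≥0⦄, (1 / 3 : ℝ≥0) < n → ∀ ⦃u : ℝ → 𝕋³ → ℝ³⦄, IsWeakEulerSolution T u →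
    UniformHolderOn (Ioo 0 T) n u → ConservesEnergyAEOn T u

/-- **Onsager's criterion, dissipative reading** (Onsager 1949, closing paragraph): a weak Euler
flow on `T³ × (0,T)` that does *not* conserve energy obeys no uniform Hölder condition (26) of any
order `n > 1/3` — "ideal" turbulent dissipation forces Hölder singularities of exponent `≤ 1/3`.
Immediate contrapositive of `Onsager1949_energyConservation`. [cite: Onsager1949, closing paragraph] -/
theorem Onsager1949_energyConservation.not_uniformHolderOn (h : Onsager1949_energyConservation)
    {T : ℝ} {n : ℝ≥0} (hn : (1 / 3 : ℝ≥0) < n) {u : ℝ → 𝕋³ → ℝ³} (hu : IsWeakEulerSolution T u)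
    (hE : ¬ConservesEnergyAEOn T u) : ¬UniformHolderOn (Ioo 0 T) n u :=
  fun hH => hE (h hn hu hH)

/-- Onsager's claim covers the tree's class `L^∞((0,T); C^{0,n}(T³))`, `n > 1/3`. [folklore] -/
theorem Onsager1949_energyConservation.of_holderUniformlyBoundedOn
    (h : Onsager1949_energyConservation) {T : ℝ} {n : ℝ≥0} (hn : (1 / 3 : ℝ≥0) < n)
    {u : ℝ → 𝕋³ → ℝ³} (hu : IsWeakEulerSolution T u)
    (hH : FunctionSpaces.HolderUniformlyBoundedOn (Ioo 0 T) n u) : ConservesEnergyAEOn T u :=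
  h hn hu hH.uniformHolderOn

/-- **Dissipation without viscosity** (Onsager 1949: "in three dimensions a mechanism for complete
dissipation of all kinetic energy, even without the aid of viscosity, is available" (end of the
two-dimensional section); "turbulent dissipation as described could take place just as readily
without the final assistance by viscosity" (closing paragraph)). Rendered minimally: there is a
weak solution of the incompressible Euler equations on `T³ × (0,T)`, `T > 0`, whose kinetic
energy is **not** conserved (not a.e. constant in time). Proved in print: Scheffer 1993 and
Shnirelman 1997/2000 (`d = 2`, `L²`), De Lellis–Székelyhidi, Ann. Math. 170 (2009), Thm. 1.1–1.2
(`L^∞`, any `d ≥ 2`), Isett 2018 (`C^{1/3-ε}`); derived below from the tree's flexibility fact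
`Turb.onsager_flexibility_strictAntiOn`. [cite: Onsager1949, §Turbulence, closing paragraph] -/
def Onsager1949_inviscidDissipation : Prop :=
  ∃ T : ℝ, 0 < T ∧ ∃ u : ℝ → 𝕋³ → ℝ³, IsWeakEulerSolution T u ∧ ¬ConservesEnergyAEOn T u

/-- A strictly decreasing energy profile on `[0,T]`, `T > 0`, is not a.e. constant on `(0,T)`. [folklore] -/
theorem not_conservesEnergyAEOn_of_strictAntiOn {T : ℝ} (hT : 0 < T) {u : ℝ → 𝕋³ → ℝ³}
    (he : StrictAntiOn (energyProfile u) (Icc 0 T)) : ¬ConservesEnergyAEOn T u := by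
  intro hcons
  obtain ⟨c, hc⟩ := (conservesEnergyAEOn_iff_exists_ae_eq_const hT).1 hcons
  have hne : (volume.restrict (Ioo (0 : ℝ) T)) ≠ 0 := by
    rw [Ne, Measure.restrict_eq_zero, Real.volume_Ioo]
    simpa using hT
  haveI : (ae (volume.restrict (Ioo (0 : ℝ) T))).NeBot := ae_neBot.mpr hne
  have hmem : ∀ᵐ t ∂(volume.restrict (Ioo (0 : ℝ) T)), t ∈ Ioo 0 T := ae_restrict_mem measurableSet_Ioo
  -- a first time with energy `c`
  obtain ⟨t₁, ht₁c, ht₁⟩ := (hc.and hmem).exists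
  -- a second, different time with energy `c`
  have havoid : ∀ᵐ t ∂(volume.restrict (Ioo (0 : ℝ) T)), t ∉ ({t₁} : Set ℝ) :=
    ae_restrict_of_ae (measure_eq_zero_iff_ae_notMem.1 (measure_singleton t₁))
  obtain ⟨t₂, ht₂c, ht₂, ht₂ne⟩ := (hc.and (hmem.and havoid)).exists
  have h12 : energyProfile u t₁ = energyProfile u t₂ := by rw [ht₁c, ht₂c]
  exact ht₂ne (he.injOn (Ioo_subset_Icc_self ht₂) (Ioo_subset_Icc_self ht₁) h12.symm)

/-- Onsager's dissipation-without-viscosity claim follows from Onsager flexibility in Isett's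
dissipative form (`Turb.onsager_flexibility_strictAntiOn`, exponent `0 < 1/3`, `T = 1`). [folklore] -/
theorem Onsager1949_inviscidDissipation_of_flexibility (h : onsager_flexibility_strictAntiOn) :
    Onsager1949_inviscidDissipation := by
  obtain ⟨u, hu, -, he⟩ := h (α := 0) (by norm_num) (T := 1) one_pos
  exact ⟨1, one_pos, u, hu, not_conservesEnergyAEOn_of_strictAntiOn one_pos he⟩

/-- Combining Onsager's two claims: the dissipative ideal flows whose existence he asserts obey no
uniform Hölder condition of order `> 1/3` (Onsager 1949, closing paragraph). [cite: Onsager1949, closing paragraph] -/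
theorem Onsager1949_exists_not_uniformHolderOn (h₁ : Onsager1949_energyConservation)
    (h₂ : Onsager1949_inviscidDissipation) :
    ∃ T : ℝ, 0 < T ∧ ∃ u : ℝ → 𝕋³ → ℝ³, IsWeakEulerSolution T u ∧
      ∀ n : ℝ≥0, (1 / 3 : ℝ≥0) < n → ¬UniformHolderOn (Ioo 0 T) n u := by
  obtain ⟨T, hT, u, hu, hE⟩ := h₂
  exact ⟨T, hT, u, hu, fun n hn => h₁.not_uniformHolderOn hn hu hE⟩

end Claims

end Turb

end Literature.Analysis.FluidPDE

end
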